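import Mathlib

/-!
# Tier4/Line4/SparsityScale — the real-variable piece of the sparsity scale of C-L4-TAIL

Blind re-derivation cell `pub-hodge-repro`, Tier 4 «PROVE THE STEP», LINE L4 (C-L4-TAIL; lead's (R-28)(c) STATUS S15087:
L1-p3 owns the sparsity off the fibre `SparsityOffFibre`, L3-p2 «the real-variable piece — the `log`/`max`/exponent-2
arithmetic, the threshold constants — and the consumers' shape check of x2's `hR` against that point form»), seat t4-L3-p2 (g3).

* L1-p3's point form concludes `Real.log (max 1 ((N : ℝ) − B)) ≤ 2 * archDist (t⁻¹ γ t') + c'`; x2's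
  `exists_norm_J_sub_sum_orbital_le_family` (TailLayerCakeFibre p702564) asks `g N ≤ d (t⁻¹ γ t')` and, for the limit, a
  scale `g` with `Tendsto g atTop atTop`.  The bridge is `g N := (Real.log (max 1 ((N : ℝ) − B)) − c') / 2`:
  `sparsityScale_le_of_le_two_mul_add` (the arithmetic), `tendsto_sparsityScale` (the limit along the levels `N`), and
  `tendsto_sparsityScale_pow` (the limit along the level family `q ^ n` of the lead's (R-28)(b), `2 ≤ q`).
* The shape check itself: with `d := archDist`, `F :=` the (finite) fibre of the orbit invariant and this `g`, L1-p3's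
  conclusion IS x2's `hR` binder — `hR_of_sparsity`, generic in the predicate.

Nothing here says anything about the status of the Hodge conjecture for CM abelian varieties, which is NOT proved
(HC_CM is NOT proved by anyone in this repository).
-/

set_option autoImplicit false

noncomputable section

namespace Summit.Ventures.HodgeRepro.Tier4.Line4

open Filter Topology

/-- The sparsity scale: half the `log⁺` of `N − B`, shifted by the constant of the read-out. -/
theorem sparsityScale_le_of_le_two_mul_add {a d c' : ℝ} (h : a ≤ 2 * d + c') : (a - c') / 2 ≤ d := by
  rw [div_le_iff₀ (by norm_num : (0 : ℝ) < 2)]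
  linarith

/-- `log (max 1 (N − B)) → ∞` along the levels. -/
theorem tendsto_log_max_one_sub_atTop (B : ℝ) :
    Tendsto (fun N : ℕ => Real.log (max 1 ((N : ℝ) - B))) atTop atTop := by
  refine Real.tendsto_log_atTop.comp ?_
  refine tendsto_atTop_mono (fun N => le_max_right _ _) ?_
  exact tendsto_atTop_add_const_right _ (-B) tendsto_natCast_atTop_atTop |>.congr fun N => by ring

/-- **THE SPARSITY SCALE TENDS TO INFINITY** along the levels `N`. -/
theorem tendsto_sparsityScale (B c' : ℝ) :
    Tendsto (fun N : ℕ => (Real.log (max 1 ((N : ℝ) - B)) - c') / 2) atTop atTop := by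
  have h := tendsto_log_max_one_sub_atTop B
  exact (tendsto_atTop_add_const_right _ (-c') h |>.congr fun N => by ring).atTop_div_const (by norm_num)

/-- `q ^ n → ∞` as a real sequence for `2 ≤ q`. -/
theorem tendsto_pow_natCast_atTop {q : ℕ} (hq : 2 ≤ q) :
    Tendsto (fun n : ℕ => ((q : ℝ) ^ n)) atTop atTop := by
  refine tendsto_pow_atTop_atTop_of_one_lt ?_
  exact_mod_cast hq

/-- **THE SPARSITY SCALE ALONG `q ^ n`** (the lead's (R-28)(b) level family, one prime `q ≥ 2`) tends to infinity. -/
theorem tendsto_sparsityScale_pow {q : ℕ} (hq : 2 ≤ q) (B c' : ℝ) :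
    Tendsto (fun n : ℕ => (Real.log (max 1 ((q : ℝ) ^ n - B)) - c') / 2) atTop atTop := by
  have h1 : Tendsto (fun n : ℕ => Real.log (max 1 ((q : ℝ) ^ n - B))) atTop atTop := by
    refine Real.tendsto_log_atTop.comp ?_
    refine tendsto_atTop_mono (fun n => le_max_right _ _) ?_
    exact tendsto_atTop_add_const_right _ (-B) (tendsto_pow_natCast_atTop hq) |>.congr fun n => by ring
  exact (tendsto_atTop_add_const_right _ (-c') h1 |>.congr fun n => by ring).atTop_div_const (by norm_num)

/-- **THE CONSUMERS' SHAPE CHECK**: a sparsity read-out in L1-p3's point form (`log (max 1 (N − B)) ≤ 2 · d + c'` at every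
support point off the fibre) is x2's `hR` binder with the scale `g N = (log (max 1 (N − B)) − c') / 2` — generic in the
ambient type, the size `d`, the support predicate and the off-fibre predicate. -/
theorem hR_of_sparsity {G : Type} {ι : Type} (d : G → ℝ) (B c' : ℝ) (off : ι → Prop) (pt : ℕ → ι → G)
    (supp : ℕ → ι → Prop)
    (hs : ∀ N i, off i → supp N i → Real.log (max 1 ((N : ℝ) - B)) ≤ 2 * d (pt N i) + c') :
    ∀ N i, off i → supp N i → (Real.log (max 1 ((N : ℝ) - B)) - c') / 2 ≤ d (pt N i) :=
  fun N i ho hsup => sparsityScale_le_of_le_two_mul_add (hs N i ho hsup)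

/-! ## Append (v2): the denominator form of the scale (L1-p3 g4, STATUS S15387: a rational `γ₀` with denominator `D`
gives the congruence modulo `N / D²`, so the threshold reads `log (max 1 (N / D² − B))`). -/

/-- `(N : ℝ) / D → ∞` for `D > 0`. -/
theorem tendsto_natCast_div_atTop {D : ℝ} (hD : 0 < D) :
    Tendsto (fun N : ℕ => (N : ℝ) / D) atTop atTop :=
  tendsto_natCast_atTop_atTop.atTop_div_const hD

/-- **THE SPARSITY SCALE IN THE DENOMINATOR FORM** tends to infinity along the levels `N`, for any `D > 0`. -/
theorem tendsto_sparsityScale_div {D : ℝ} (hD : 0 < D) (B c' : ℝ) :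
    Tendsto (fun N : ℕ => (Real.log (max 1 ((N : ℝ) / D - B)) - c') / 2) atTop atTop := by
  have h1 : Tendsto (fun N : ℕ => Real.log (max 1 ((N : ℝ) / D - B))) atTop atTop := by
    refine Real.tendsto_log_atTop.comp ?_
    refine tendsto_atTop_mono (fun N => le_max_right _ _) ?_
    exact tendsto_atTop_add_const_right _ (-B) (tendsto_natCast_div_atTop hD) |>.congr fun N => by ring
  exact (tendsto_atTop_add_const_right _ (-c') h1 |>.congr fun N => by ring).atTop_div_const (by norm_num)

/-- **THE DENOMINATOR FORM ALONG `q ^ n`**, `2 ≤ q`, `D > 0`. -/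
theorem tendsto_sparsityScale_pow_div {q : ℕ} (hq : 2 ≤ q) {D : ℝ} (hD : 0 < D) (B c' : ℝ) :
    Tendsto (fun n : ℕ => (Real.log (max 1 ((q : ℝ) ^ n / D - B)) - c') / 2) atTop atTop := by
  have h0 : Tendsto (fun n : ℕ => (q : ℝ) ^ n / D) atTop atTop :=
    (tendsto_pow_natCast_atTop hq).atTop_div_const hD
  have h1 : Tendsto (fun n : ℕ => Real.log (max 1 ((q : ℝ) ^ n / D - B))) atTop atTop := by
    refine Real.tendsto_log_atTop.comp ?_
    refine tendsto_atTop_mono (fun n => le_max_right _ _) ?_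
    exact tendsto_atTop_add_const_right _ (-B) h0 |>.congr fun n => by ring
  exact (tendsto_atTop_add_const_right _ (-c') h1 |>.congr fun n => by ring).atTop_div_const (by norm_num)

/-! ## Append (v3): the shifted level family `n ↦ q ^ (n + n₁)` (crit-1 g10, STATUS S15441). -/

/-- **THE DENOMINATOR FORM ALONG `q ^ (n + n₁)`**: the scale composed with the shift `n ↦ n + n₁`. -/
theorem tendsto_sparsityScale_pow_div_shift {q : ℕ} (hq : 2 ≤ q) {D : ℝ} (hD : 0 < D) (B c' : ℝ) (n₁ : ℕ) :
    Tendsto (fun n : ℕ => (Real.log (max 1 ((q : ℝ) ^ (n + n₁) / D - B)) - c') / 2) atTop atTop :=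
  (tendsto_sparsityScale_pow_div hq hD B c').comp (tendsto_add_atTop_nat n₁)

end Summit.Ventures.HodgeRepro.Tier4.Line4

end
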